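import Summits.NavierStokesRegularity.NavierStokesRegularity.Theses.AxisymmetricExtremality
import Summits.NavierStokesRegularity.NavierStokesRegularity.Theorems.AxisymmetricExtremalityPFoldToAxisymmetric
import Summits.NavierStokesRegularity.NavierStokesRegularity.Theorems.AxisymmetricLiouvilleBoundedSwirl
import Literature.Analysis.FluidPDE.AxisymmetricEuler
import HarnessLib

/-!
# Strategist census s19-g15 — Lean companion (crux `AxisymmetricKatoGlobal`, item stmt-NavierStokesRegularity-15453)

Sorry-free typing of the statements examined in `STRATEGY-CENSUS-s19-g15.md` (route
`AxisymmetricExtremality`; the crux decl is FIXED and is only referred to by name):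

* §W (weaker intermediate consumed by `closes`): the THRESHOLD INSTANCE
  `NoAxisymMinimalDatum` ("Rusin–Šverák's minimal blow-up set `M(ν)` contains no axisymmetric
  datum"), its large-`p` discrete form `NoPFoldMinimalDataEventually`, and the kernel-checked facts
  crux ⇒ threshold, threshold + `MinimalDatumPFold` ⇒ summit (using the PROVED sibling crux
  `PFoldToAxisymmetric`), summit ⇒ `MinimalDatumPFold` (vacuity), threshold ⇔ discrete form;
* §D (decomposition): the swirl / no-swirl split with its proved join, at crux level and at
  threshold level;
* §S (strengthen): the typed Liouville statement (AX-L) = the canonical conjecture leaf, by name;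
* §N (negation): the negated crux, by name.

Nothing here is a new route, a new item, or an edit of the lead's skeleton; no `sorry`.
-/

set_option linter.dupNamespace false
set_option linter.unusedVariables false

namespace Summit.NavierStokesRegularity.NavierStokesRegularity.Cruxes.AxisymmetricKatoGlobal.StrategistS19g15

open MeasureTheory
open Literature.Analysis.FluidPDE Literature.Analysis.FunctionSpaces
open Summit.NavierStokesRegularity.NavierStokesRegularity.Theses.AxisymmetricExtremality

/-- `ℝ³` as in the route file. -/
abbrev E3 : Type := EuclideanSpace ℝ (Fin 3)

/-- The crux's symmetry hypothesis verbatim: equivariance under EVERY rotation about the `x 2`-axis,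
written out (`= IsAxisymmetric u₀`, `Iff.rfl`, see `rotEquivariantAll_iff`). -/
def RotEquivariantAll (u₀ : E3 → E3) : Prop :=
  ∀ (θ : ℝ) (x : E3), u₀ (WithLp.toLp 2 ![Real.cos θ * x 0 - Real.sin θ * x 1,
      Real.sin θ * x 0 + Real.cos θ * x 1, x 2]) =
    WithLp.toLp 2 ![Real.cos θ * u₀ x 0 - Real.sin θ * u₀ x 1,
      Real.sin θ * u₀ x 0 + Real.cos θ * u₀ x 1, u₀ x 2]

/-- `p`-fold symmetry verbatim as in `MinimalDatumPFold` / `PFoldToAxisymmetric`: equivariance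
under the rotation by `2π/p` about the `x 2`-axis. -/
def RotEquivariantStep (p : ℕ) (u₀ : E3 → E3) : Prop :=
  ∀ x : E3, u₀ (WithLp.toLp 2 ![Real.cos (2 * Real.pi / p) * x 0 - Real.sin (2 * Real.pi / p) * x 1,
      Real.sin (2 * Real.pi / p) * x 0 + Real.cos (2 * Real.pi / p) * x 1, x 2]) =
    WithLp.toLp 2 ![Real.cos (2 * Real.pi / p) * u₀ x 0 - Real.sin (2 * Real.pi / p) * u₀ x 1,
      Real.sin (2 * Real.pi / p) * u₀ x 0 + Real.cos (2 * Real.pi / p) * u₀ x 1, u₀ x 2]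

/-- The written-out clause IS `IsAxisymmetric` (definitional). -/
theorem rotEquivariantAll_iff (u₀ : E3 → E3) : RotEquivariantAll u₀ ↔ IsAxisymmetric u₀ := Iff.rfl

/-- An axisymmetric field is `p`-fold symmetric for every `p`. -/
theorem rotEquivariantStep_of_all {u₀ : E3 → E3} (h : RotEquivariantAll u₀) (p : ℕ) :
    RotEquivariantStep p u₀ := fun x => h _ x

/-! ## §W — the weakest statement `closes` consumes: the threshold instance -/

/-- **T (threshold instance).** For every `ν > 0`, Rusin–Šverák's set `M(ν)` of `Ḣ^{1/2}`-minimal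
blow-up data contains no datum axisymmetric about the `x 2`-axis. This is exactly what the
route's `closes` extracts from the crux (it destructures the minimal datum and feeds its
`L³ / Represents / div-free` clauses to AX_H). -/
def NoAxisymMinimalDatum : Prop :=
  ∀ ν : ℝ, 0 < ν → ¬ ∃ (u₀ : E3 → E3) (g : HomSobolev E3 (EuclideanSpace ℂ (Fin 3)) (1 / 2 : ℝ)),
    IsMinimalBlowupDatum ν u₀ g ∧ RotEquivariantAll u₀

/-- **V (discrete form).** For every `ν > 0` there is `N` such that no `p`-fold symmetric minimal
blow-up datum exists for `p ≥ N` (`p ≥ 2`). -/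
def NoPFoldMinimalDataEventually : Prop :=
  ∀ ν : ℝ, 0 < ν → ∃ N : ℕ, ∀ p : ℕ, N ≤ p → 2 ≤ p →
    ¬ ∃ (u₀ : E3 → E3) (g : HomSobolev E3 (EuclideanSpace ℂ (Fin 3)) (1 / 2 : ℝ)),
      IsMinimalBlowupDatum ν u₀ g ∧ RotEquivariantStep p u₀

/-- crux ⇒ T (the only use `closes` makes of the crux). -/
theorem noAxisymMinimalDatum_of_crux (h : AxisymmetricKatoGlobal) : NoAxisymMinimalDatum := by
  intro ν hν ⟨u₀, g, hmin, hax⟩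
  obtain ⟨hL3, hrep, hdiv, -, hnot⟩ := hmin
  exact hnot (h ν hν u₀ g hL3 hrep hdiv hax)

/-- T replaces the crux in the deciding theorem (same three lines of logic as `closes`). -/
theorem summit_of_threshold (h₂ : MinimalDatumPFold) (h₄ : PFoldToAxisymmetric)
    (hT : NoAxisymMinimalDatum) : NavierStokesRegularity := by
  show Literature.NS.NavierStokesExistenceSmoothR3
  intro ν hν u₀ hsm hdiv hdec
  by_contra hno
  obtain ⟨u₁, g, hmin, hax⟩ := h₄ ν hν (h₂ ν hν ⟨u₀, hsm, hdiv, hdec, hno⟩)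
  exact hT ν hν ⟨u₁, g, hmin, hax⟩

/-- … and with the PROVED sibling crux discharged by its landed theorem. -/
theorem summit_of_threshold' (h₂ : MinimalDatumPFold) (hT : NoAxisymMinimalDatum) :
    NavierStokesRegularity :=
  summit_of_threshold h₂ Theorems.axisymmetricExtremality_pFoldToAxisymmetric_proof hT

/-- summit ⇒ `MinimalDatumPFold` (vacuity of the Clay-failure antecedent). -/
theorem minimalDatumPFold_of_summit (hS : NavierStokesRegularity) : MinimalDatumPFold := by
  intro ν hν ⟨v₀, hsm, hdiv, hdec, hno⟩
  exact absurd (hS ν hν v₀ hsm hdiv hdec) hno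

/-- The summit relative to the open sibling: `S ↔ MinimalDatumPFold ∧ (T ∨ S)`. (T itself is NOT a
consequence of S over the tree: S speaks of Schwartz-class data, `M(ν)` lives in `L³ ∩ Ḣ^{1/2}`;
the transcription is the open Rusin–Šverák question.) -/
theorem summit_iff_pfold_and_threshold_or :
    NavierStokesRegularity ↔ MinimalDatumPFold ∧ (NoAxisymMinimalDatum ∨ NavierStokesRegularity) := by
  constructor
  · exact fun hS => ⟨minimalDatumPFold_of_summit hS, Or.inr hS⟩
  · rintro ⟨h₂, hT | hS⟩
    · exact summit_of_threshold' h₂ hT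
    · exact hS

/-- V ⇒ T: an axisymmetric minimal datum is `p`-fold for every `p`. -/
theorem noAxisym_of_noPFold (hV : NoPFoldMinimalDataEventually) : NoAxisymMinimalDatum := by
  intro ν hν ⟨u₀, g, hmin, hax⟩
  obtain ⟨N, hN⟩ := hV ν hν
  exact hN (max N 2) (le_max_left _ _) (le_max_right _ _)
    ⟨u₀, g, hmin, rotEquivariantStep_of_all hax _⟩

/-- T ⇒ V, through the sibling crux `PFoldToAxisymmetric` (PROVED): if `p`-fold minimal data
existed for unboundedly many `p`, an axisymmetric one would exist. -/
theorem noPFold_of_noAxisym (h₄ : PFoldToAxisymmetric) (hT : NoAxisymMinimalDatum) :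
    NoPFoldMinimalDataEventually := by
  intro ν hν
  by_contra hcon
  push Not at hcon
  exact hT ν hν (h₄ ν hν hcon)

/-- V ⇔ T over the tree. -/
theorem noPFold_iff_noAxisym : NoPFoldMinimalDataEventually ↔ NoAxisymMinimalDatum :=
  ⟨noAxisym_of_noPFold,
    noPFold_of_noAxisym Theorems.axisymmetricExtremality_pFoldToAxisymmetric_proof⟩

/-! ## §D — the swirl / no-swirl split (typed, join proved; the swirl half is the crux) -/

/-- No-swirl half of AX_H in the critical class. -/
def NoSwirlKatoGlobal : Prop :=
  ∀ ν : ℝ, 0 < ν → ∀ (u₀ : E3 → E3) (g : HomSobolev E3 (EuclideanSpace ℂ (Fin 3)) (1 / 2 : ℝ)),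
    MemLp u₀ 3 volume → g.Represents (Literature.Analysis.FunctionSpaces.EuclideanSpace.complexify ∘ u₀) →
    IsWeaklyDivFree u₀ → RotEquivariantAll u₀ → HasNoSwirl u₀ → HasGlobalKatoSolution ν u₀

/-- Swirl half of AX_H in the critical class (= the crux minus a classical case). -/
def SwirlKatoGlobal : Prop :=
  ∀ ν : ℝ, 0 < ν → ∀ (u₀ : E3 → E3) (g : HomSobolev E3 (EuclideanSpace ℂ (Fin 3)) (1 / 2 : ℝ)),
    MemLp u₀ 3 volume → g.Represents (Literature.Analysis.FunctionSpaces.EuclideanSpace.complexify ∘ u₀) →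
    IsWeaklyDivFree u₀ → RotEquivariantAll u₀ → ¬ HasNoSwirl u₀ → HasGlobalKatoSolution ν u₀

/-- The join of the swirl split (pure logic). -/
theorem crux_of_swirlSplit (h₁ : NoSwirlKatoGlobal) (h₂ : SwirlKatoGlobal) : AxisymmetricKatoGlobal := by
  intro ν hν u₀ g hL3 hrep hdiv hax
  by_cases hs : HasNoSwirl u₀
  · exact h₁ ν hν u₀ g hL3 hrep hdiv hax hs
  · exact h₂ ν hν u₀ g hL3 hrep hdiv hax hs

/-- Both halves are implied by the crux (so the split is faithful). -/
theorem swirlSplit_of_crux (h : AxisymmetricKatoGlobal) : NoSwirlKatoGlobal ∧ SwirlKatoGlobal :=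
  ⟨fun ν hν u₀ g hL3 hrep hdiv hax _ => h ν hν u₀ g hL3 hrep hdiv hax,
    fun ν hν u₀ g hL3 hrep hdiv hax _ => h ν hν u₀ g hL3 hrep hdiv hax⟩

/-- Threshold-level no-swirl half: no axisymmetric swirl-free minimal blow-up datum. -/
def NoAxisymNoSwirlMinimalDatum : Prop :=
  ∀ ν : ℝ, 0 < ν → ¬ ∃ (u₀ : E3 → E3) (g : HomSobolev E3 (EuclideanSpace ℂ (Fin 3)) (1 / 2 : ℝ)),
    IsMinimalBlowupDatum ν u₀ g ∧ RotEquivariantAll u₀ ∧ HasNoSwirl u₀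

/-- Threshold-level swirl half: no axisymmetric minimal blow-up datum WITH swirl. -/
def NoAxisymSwirlMinimalDatum : Prop :=
  ∀ ν : ℝ, 0 < ν → ¬ ∃ (u₀ : E3 → E3) (g : HomSobolev E3 (EuclideanSpace ℂ (Fin 3)) (1 / 2 : ℝ)),
    IsMinimalBlowupDatum ν u₀ g ∧ RotEquivariantAll u₀ ∧ ¬ HasNoSwirl u₀

/-- Join at threshold level. -/
theorem threshold_of_swirlSplit (h₁ : NoAxisymNoSwirlMinimalDatum) (h₂ : NoAxisymSwirlMinimalDatum) :
    NoAxisymMinimalDatum := by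
  intro ν hν ⟨u₀, g, hmin, hax⟩
  by_cases hs : HasNoSwirl u₀
  · exact h₁ ν hν ⟨u₀, g, hmin, hax, hs⟩
  · exact h₂ ν hν ⟨u₀, g, hmin, hax, hs⟩

/-- The no-swirl crux half gives the no-swirl threshold half. -/
theorem noAxisymNoSwirlMinimalDatum_of_noSwirlKatoGlobal (h₁ : NoSwirlKatoGlobal) :
    NoAxisymNoSwirlMinimalDatum := by
  intro ν hν ⟨u₀, g, hmin, hax, hs⟩
  obtain ⟨hL3, hrep, hdiv, -, hnot⟩ := hmin
  exact hnot (h₁ ν hν u₀ g hL3 hrep hdiv hax hs)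

/-! ## §S — strengthen: the Liouville form is a typed OPEN leaf, cited by name -/

/-- (AX-L), the canonical conjecture leaf (KNSS 2009 §5; bounded-swirl form). Recorded here only
to fix WHICH statement §S of the census discusses; it is neither assumed nor claimed. -/
abbrev LiouvilleAXL : Prop :=
  Summit.NavierStokesRegularity.NavierStokesRegularity.AxisymmetricLiouvilleBoundedSwirl

/-! ## §N — negation: the negated crux, by name -/

/-- The negation side is just `¬ crux`: some `ν > 0` and some axisymmetric critical datum without a
global Kato solution. -/
abbrev CruxFails : Prop := ¬ AxisymmetricKatoGlobal

/-- Sanity: a refutation of T refutes the crux (contrapositive of `noAxisymMinimalDatum_of_crux`). -/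
theorem cruxFails_of_axisymMinimalDatum {ν : ℝ} (hν : 0 < ν) {u₀ : E3 → E3}
    {g : HomSobolev E3 (EuclideanSpace ℂ (Fin 3)) (1 / 2 : ℝ)}
    (hmin : IsMinimalBlowupDatum ν u₀ g) (hax : RotEquivariantAll u₀) : CruxFails :=
  fun h => noAxisymMinimalDatum_of_crux h ν hν ⟨u₀, g, hmin, hax⟩

end Summit.NavierStokesRegularity.NavierStokesRegularity.Cruxes.AxisymmetricKatoGlobal.StrategistS19g15
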